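import Literature.Analysis.FluidPDE.NSBoundedMildOseenDuhamel
import Literature.Analysis.UnboundedOperators.HeatKernelBoundedData
import Literature.Analysis.UnboundedOperators.HeatExtensionDecay
import HarnessLib

/-!
# Uniform Hölder modulus of bounded solutions of the Oseen integral equation

Analysis/FluidPDE support file (everything proved, no definitions) for the discharge of
`Literature.Analysis.FluidPDE.KNSS2009_typeI_rate_compactness` (Koch–Nadirashvili–Seregin–Šverák
2009, Lemma 6.1, arXiv:0709.3599 p. 11: uniformly bounded mild solutions have a locally uniformly
convergent subsequence — "an easy consequence of the results in Section 4"; Lemma 4.1, p. 8: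
"a routine consequence of (4.5) and the decay estimate (3.8) for the kernel"). The compactness
needs only **equicontinuity with constants depending on the bound**, which this file proves in
an elementary way from the restart form of the integral equation
`u(t) = e^{(t−s)Δ}u(s) − B¹_s(u,u)(t)` (`UnboundedOperators.heatExtension`, `oseenDuhamel`),
without the smoothing estimates (4.5):

* `norm_heatExtension_sub_le_mul_norm_sub_of_bound` — the caloric extension of bounded
  continuous data is Lipschitz, `‖e^{σΔ}f(x') − e^{σΔ}f(x)‖ ≤ 2^{n/2} σ^{-1/2} M ‖x' − x‖`
  (the tree's gradient bound `norm_fderiv_heatExtension_le_of_bounded` and the mean value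
  inequality);
* `exists_holder_quarter_of_oseenMild` — **the modulus**: there is `K₀ = K₀(E)` such that every
  field `u` with continuous slices bounded by `m` on `[a, b] × E` which satisfies the Oseen
  identity between all pairs of times `a ≤ s < t ≤ b` obeys
  `‖u(t', x') − u(t, x)‖ ≤ K₀ (m + m²) max(|t' − t|, ‖x' − x‖)^{1/4}` for `t, t' ∈ [a + 1, b]`.
  Proof: restarting at `t − ε` writes `u(t) = e^{εΔ}u(t−ε) − B¹_{t−ε}(u,u)(t)` with the first
  term `2^{n/2}ε^{-1/2}m`-Lipschitz and the second bounded by `2C m² √ε`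
  (`exists_norm_oseenDuhamel_bounded_le`, KNSS (4.4)), whence the space modulus
  `2^{n/2} m ε^{-1/2}‖x' − x‖ + 4C m²√ε`; restarting at `t` writes
  `u(t + h) − u(t) = (e^{hΔ}u(t) − u(t)) − B¹_t(u,u)(t + h)`, and `e^{hΔ}g − g = O(Lip(g)√h)`
  (`norm_heatExtension_sub_self_le_of_holder`) applied to the Lipschitz part of `u(t)` gives the
  time modulus `C' m √h/√ε + 4C m²√ε + 2C m²√h`; the choice `ε = √δ` yields the exponent `1/4`.

## References

* G. Koch, N. Nadirashvili, G. Seregin, V. Šverák, *Liouville theorems for the Navier–Stokes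
  equations and applications*, Acta Math. 203 (2009) = arXiv:0709.3599, §4 p. 8 ((4.3)–(4.5),
  Lemma 4.1) and §6 Lemma 6.1 p. 11. [KochNadirashviliSereginSverak2009]
-/

noncomputable section

open MeasureTheory Set Function Filter
open _root_.Topology

namespace Literature.Analysis.FluidPDE

variable {E : Type*} [NormedAddCommGroup E] [InnerProductSpace ℝ E] [FiniteDimensional ℝ E]
  [MeasurableSpace E] [BorelSpace E]
variable {F : Type*} [NormedAddCommGroup F] [NormedSpace ℝ F] [CompleteSpace F]

/-! ### The caloric extension of bounded continuous data is Lipschitz -/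

/-- **Lipschitz bound for the caloric extension of bounded continuous data**:
`‖e^{σΔ}f(x') − e^{σΔ}f(x)‖ ≤ 2^{n/2} σ^{-1/2} M ‖x' − x‖` whenever `‖f‖ ≤ M` (mean value
inequality with the sup-norm gradient estimate of Giga–Giga–Saal, §1.1.3, the tree's
`norm_fderiv_heatExtension_le_of_bounded`). [folklore] -/
theorem norm_heatExtension_sub_le_mul_norm_sub_of_bound {f : E → F} (hf : Continuous f) {M : ℝ}
    (hM : ∀ z, ‖f z‖ ≤ M) {σ : ℝ} (hσ : 0 < σ) (x x' : E) :
    ‖UnboundedOperators.heatExtension f σ x' - UnboundedOperators.heatExtension f σ x‖ ≤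
      (2 : ℝ) ^ ((Module.finrank ℝ E : ℝ) / 2) * σ ^ (-(1 / 2 : ℝ)) * M * ‖x' - x‖ := by
  have hdiff : ∀ y ∈ (univ : Set E), DifferentiableAt ℝ (UnboundedOperators.heatExtension f σ) y :=
    fun y _ => ((UnboundedOperators.contDiff_heatExtension_of_bound hf hM hσ (m := 1)).differentiable
      (by simp)) y
  have hbound : ∀ y ∈ (univ : Set E), ‖fderiv ℝ (UnboundedOperators.heatExtension f σ) y‖ ≤
      (2 : ℝ) ^ ((Module.finrank ℝ E : ℝ) / 2) * σ ^ (-(1 / 2 : ℝ)) * M := fun y _ =>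
    UnboundedOperators.norm_fderiv_heatExtension_le_of_bounded hf.aestronglyMeasurable hM hσ y
  exact Convex.norm_image_sub_le_of_norm_fderiv_le hdiff hbound convex_univ (mem_univ x) (mem_univ x')

/-! ### The uniform Hölder modulus -/

omit [MeasurableSpace E] [BorelSpace E] in
/-- Elementary: for `0 < c ≤ 1`, `(c ^ 2) ^ (-(1/2)) = c⁻¹`. [folklore] -/
theorem sq_rpow_neg_half_eq_inv {c : ℝ} (hc : 0 < c) : (c ^ 2) ^ (-(1 / 2 : ℝ)) = c⁻¹ := by
  rw [show c ^ 2 = c ^ (2 : ℝ) by norm_cast, ← Real.rpow_mul hc.le]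
  norm_num
  exact Real.rpow_neg_one c

/-- **Uniform `1/4`-Hölder modulus of bounded solutions of the Oseen integral equation** (the
equicontinuity behind KNSS 2009, Lemma 4.1 / Lemma 6.1, with constants depending only on the
bound): there is `K₀ = K₀(E) > 0` such that for every field `u : ℝ → E → E` whose slices
`u t`, `t ∈ [a, b]`, are continuous and bounded by `m ≥ 0`, and which satisfies
`u(t) = e^{(t−s)Δ}u(s) − B¹_s(u,u)(t)` pointwise for all `a ≤ s < t ≤ b`, one has
`‖u(t', x') − u(t, x)‖ ≤ K₀ (m + m²) max(|t' − t|, ‖x' − x‖)^{1/4}` for all `t, t' ∈ [a + 1, b]`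
and all `x, x'`. See the module docstring for the proof. [cite: KochNadirashviliSereginSverak2009, Lemma 4.1 and Lemma 6.1 (arXiv:0709.3599 pp. 8, 11)] -/
theorem exists_holder_quarter_of_oseenMild :
    ∃ K₀ : ℝ, 0 < K₀ ∧ ∀ ⦃u : ℝ → E → E⦄ ⦃a b m : ℝ⦄, 0 ≤ m →
      (∀ t ∈ Icc a b, Continuous (u t)) →
      (∀ t ∈ Icc a b, ∀ x, ‖u t x‖ ≤ m) →
      (∀ s t : ℝ, a ≤ s → s < t → t ≤ b → ∀ x,
        u t x = UnboundedOperators.heatExtension (u s) (t - s) x - oseenDuhamel 1 s u u t x) →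
      ∀ t ∈ Icc (a + 1) b, ∀ t' ∈ Icc (a + 1) b, ∀ x x' : E,
        ‖u t' x' - u t x‖ ≤ K₀ * (m + m ^ 2) * (max |t' - t| ‖x' - x‖) ^ (1 / 4 : ℝ) := by
  obtain ⟨C, hC, hB⟩ := exists_norm_oseenDuhamel_bounded_le (E := E)
  set D : ℝ := (2 : ℝ) ^ ((Module.finrank ℝ E : ℝ) / 2) with hD
  set H : ℝ := 1 + 2 * (2 : ℝ) ^ ((Module.finrank ℝ E : ℝ) / 2) with hH
  have hD0 : 0 < D := by positivity
  have hH0 : 0 < H := by positivity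
  refine ⟨D + H * D + 10 * C + 2, by positivity, ?_⟩
  intro u a b m hm hcont hbd hmild
  -- the Duhamel bound with `ν = 1`
  have hB1 : ∀ s t : ℝ, a ≤ s → s < t → t ≤ b → ∀ x,
      ‖oseenDuhamel 1 s u u t x‖ ≤ C * m ^ 2 * (2 * Real.sqrt (t - s)) := by
    intro s t has hst htb x
    have h := hB one_pos hst hm (fun τ hτ y => hbd τ ⟨has.trans hτ.1.le, hτ.2.le.trans htb⟩ y)
      (fun τ hτ y => hbd τ ⟨has.trans hτ.1.le, hτ.2.le.trans htb⟩ y) x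
    simpa [Real.one_rpow] using h
  -- ### the decomposition at a time `t ∈ [a + 1, b]` with lag `0 < ε ≤ 1`
  -- `u t = A − B`, `A = e^{εΔ}u(t − ε)` Lipschitz with constant `D ε^{-1/2} m`, `‖B‖ ≤ 2 C m² √ε`
  have hdec : ∀ t ∈ Icc (a + 1) b, ∀ ε : ℝ, 0 < ε → ε ≤ 1 →
      (∀ x, u t x = UnboundedOperators.heatExtension (u (t - ε)) ε x - oseenDuhamel 1 (t - ε) u u t x) ∧
      (∀ x x', ‖UnboundedOperators.heatExtension (u (t - ε)) ε x' -
          UnboundedOperators.heatExtension (u (t - ε)) ε x‖ ≤ D * ε ^ (-(1 / 2 : ℝ)) * m * ‖x' - x‖) ∧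
      (∀ x, ‖UnboundedOperators.heatExtension (u (t - ε)) ε x‖ ≤ m) ∧
      (∀ x, ‖oseenDuhamel 1 (t - ε) u u t x‖ ≤ 2 * C * m ^ 2 * Real.sqrt ε) := by
    intro t ht ε hε hε1
    have has : a ≤ t - ε := by linarith [ht.1]
    have hsI : t - ε ∈ Icc a b := ⟨has, by linarith [ht.2]⟩
    refine ⟨fun x => ?_, fun x x' => ?_, fun x => ?_, fun x => ?_⟩
    · have h := hmild (t - ε) t has (by linarith) ht.2 x
      rwa [sub_sub_cancel] at h
    · exact norm_heatExtension_sub_le_mul_norm_sub_of_bound (hcont _ hsI) (hbd _ hsI) hε x x'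
    · exact UnboundedOperators.norm_heatExtension_le_of_bound (hbd _ hsI) hε x
    · have h := hB1 (t - ε) t has (by linarith) ht.2 x
      rw [sub_sub_cancel] at h
      linarith
  -- ### space modulus
  have hspace : ∀ t ∈ Icc (a + 1) b, ∀ ε : ℝ, 0 < ε → ε ≤ 1 → ∀ x x',
      ‖u t x' - u t x‖ ≤ D * ε ^ (-(1 / 2 : ℝ)) * m * ‖x' - x‖ + 4 * C * m ^ 2 * Real.sqrt ε := by
    intro t ht ε hε hε1 x x'
    obtain ⟨hrep, hlip, -, hBb⟩ := hdec t ht ε hε hε1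
    rw [hrep x', hrep x]
    calc ‖UnboundedOperators.heatExtension (u (t - ε)) ε x' - oseenDuhamel 1 (t - ε) u u t x' -
          (UnboundedOperators.heatExtension (u (t - ε)) ε x - oseenDuhamel 1 (t - ε) u u t x)‖
        = ‖(UnboundedOperators.heatExtension (u (t - ε)) ε x' -
            UnboundedOperators.heatExtension (u (t - ε)) ε x) -
            (oseenDuhamel 1 (t - ε) u u t x' - oseenDuhamel 1 (t - ε) u u t x)‖ := by abel_nf
      _ ≤ ‖UnboundedOperators.heatExtension (u (t - ε)) ε x' -
            UnboundedOperators.heatExtension (u (t - ε)) ε x‖ +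
            (‖oseenDuhamel 1 (t - ε) u u t x'‖ + ‖oseenDuhamel 1 (t - ε) u u t x‖) :=
          (norm_sub_le _ _).trans (add_le_add le_rfl (norm_sub_le _ _))
      _ ≤ D * ε ^ (-(1 / 2 : ℝ)) * m * ‖x' - x‖ +
            (2 * C * m ^ 2 * Real.sqrt ε + 2 * C * m ^ 2 * Real.sqrt ε) :=
          add_le_add (hlip x x') (add_le_add (hBb x') (hBb x))
      _ = _ := by ring
  -- ### time modulus
  have htime : ∀ t ∈ Icc (a + 1) b, ∀ t' ∈ Icc (a + 1) b, t < t' → ∀ ε : ℝ, 0 < ε → ε ≤ 1 → ∀ x,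
      ‖u t' x - u t x‖ ≤ H * (D * ε ^ (-(1 / 2 : ℝ)) * m) * (t' - t) ^ ((1 : ℝ) / 2) +
        4 * C * m ^ 2 * Real.sqrt ε + 2 * C * m ^ 2 * Real.sqrt (t' - t) := by
    intro t ht t' ht' htt' ε hε hε1 x
    obtain ⟨hrep, hlip, hAb, hBb⟩ := hdec t ht ε hε hε1
    have hh : 0 < t' - t := sub_pos.2 htt'
    have htI : t ∈ Icc a b := ⟨by linarith [ht.1], ht.2⟩
    -- restart at `t`
    have hrep' : u t' x = UnboundedOperators.heatExtension (u t) (t' - t) x - oseenDuhamel 1 t u u t' x :=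
      hmild t t' (by linarith [ht.1]) htt' ht'.2 x
    have hB' : ‖oseenDuhamel 1 t u u t' x‖ ≤ 2 * C * m ^ 2 * Real.sqrt (t' - t) := by
      have h := hB1 t t' (by linarith [ht.1]) htt' ht'.2 x
      linarith
    -- `u t = A - Bf` with `A` Lipschitz continuous bounded, `Bf` continuous small
    set A : E → E := UnboundedOperators.heatExtension (u (t - ε)) ε with hA
    set Bf : E → E := fun z => A z - u t z with hBf
    have hAc : Continuous A :=
      (UnboundedOperators.contDiff_heatExtension_of_bound (hcont _ ⟨by linarith [ht.1], by linarith [ht.2]⟩)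
        (hbd _ ⟨by linarith [ht.1], by linarith [ht.2]⟩) hε (m := 0)).continuous
    have hBfc : Continuous Bf := hAc.sub (hcont t htI)
    have hBfeq : ∀ z, Bf z = oseenDuhamel 1 (t - ε) u u t z := fun z => by
      rw [hBf]; dsimp only; rw [hrep z]; abel
    have hBfb : ∀ z, ‖Bf z‖ ≤ 2 * C * m ^ 2 * Real.sqrt ε := fun z => by rw [hBfeq z]; exact hBb z
    have hut : u t = fun z => A z - Bf z := funext fun z => by rw [hBf]; dsimp only; abel
    have hsplit : UnboundedOperators.heatExtension (u t) (t' - t) x =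
        UnboundedOperators.heatExtension A (t' - t) x - UnboundedOperators.heatExtension Bf (t' - t) x := by
      rw [hut]
      exact UnboundedOperators.heatExtension_sub_of_bound hAc hBfc hAb hBfb hh x
    -- the mollification error for the Lipschitz part
    have hAlip : ∀ y z, ‖A y - A z‖ ≤ (D * ε ^ (-(1 / 2 : ℝ)) * m) * ‖y - z‖ ^ (1 : ℝ) := fun y z => by
      rw [Real.rpow_one]; exact hlip z y
    have hLA : 0 ≤ D * ε ^ (-(1 / 2 : ℝ)) * m := by positivity
    have hmoll : ‖UnboundedOperators.heatExtension A (t' - t) x - A x‖ ≤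
        H * (D * ε ^ (-(1 / 2 : ℝ)) * m) * (t' - t) ^ ((1 : ℝ) / 2) :=
      UnboundedOperators.norm_heatExtension_sub_self_le_of_holder hAc hAb hLA zero_le_one le_rfl hAlip hh x
    have hmollB : ‖UnboundedOperators.heatExtension Bf (t' - t) x‖ ≤ 2 * C * m ^ 2 * Real.sqrt ε :=
      UnboundedOperators.norm_heatExtension_le_of_bound hBfb hh x
    -- assemble
    have hutx : u t x = A x - Bf x := congrFun hut x
    rw [hrep', hsplit, hutx]
    calc ‖UnboundedOperators.heatExtension A (t' - t) x - UnboundedOperators.heatExtension Bf (t' - t) x -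
          oseenDuhamel 1 t u u t' x - (A x - Bf x)‖
        = ‖(UnboundedOperators.heatExtension A (t' - t) x - A x) -
            UnboundedOperators.heatExtension Bf (t' - t) x + Bf x - oseenDuhamel 1 t u u t' x‖ := by
          abel_nf
      _ ≤ ‖UnboundedOperators.heatExtension A (t' - t) x - A x‖ +
            ‖UnboundedOperators.heatExtension Bf (t' - t) x‖ + ‖Bf x‖ + ‖oseenDuhamel 1 t u u t' x‖ := by
          refine (norm_sub_le _ _).trans (add_le_add ((norm_add_le _ _).trans
            (add_le_add (norm_sub_le _ _) le_rfl)) le_rfl)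
      _ ≤ H * (D * ε ^ (-(1 / 2 : ℝ)) * m) * (t' - t) ^ ((1 : ℝ) / 2) +
            2 * C * m ^ 2 * Real.sqrt ε + 2 * C * m ^ 2 * Real.sqrt ε +
            2 * C * m ^ 2 * Real.sqrt (t' - t) :=
          add_le_add (add_le_add (add_le_add hmoll hmollB) (hBfb x)) hB'
      _ = _ := by ring
  -- ### the combination, for `t ≤ t'`
  have hK2 : (2 : ℝ) ≤ D + H * D + 10 * C + 2 := by nlinarith [hD0, hH0, hC]
  have key : ∀ t ∈ Icc (a + 1) b, ∀ t' ∈ Icc (a + 1) b, t ≤ t' → ∀ x x' : E,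
      ‖u t' x' - u t x‖ ≤ (D + H * D + 10 * C + 2) * (m + m ^ 2) * (max |t' - t| ‖x' - x‖) ^ (1 / 4 : ℝ) := by
    intro t ht t' ht' htt' x x'
    set δ : ℝ := max |t' - t| ‖x' - x‖ with hδ
    have hδ0 : 0 ≤ δ := le_max_of_le_left (abs_nonneg _)
    have htI : t ∈ Icc a b := ⟨by linarith [ht.1], ht.2⟩
    have ht'I : t' ∈ Icc a b := ⟨by linarith [ht'.1], ht'.2⟩
    -- trivial bound `2m`
    have htriv : ‖u t' x' - u t x‖ ≤ 2 * m :=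
      (norm_sub_le _ _).trans (by linarith [hbd t' ht'I x', hbd t htI x])
    rcases hδ0.eq_or_lt with hδz | hδpos
    · -- `δ = 0`: same point
      have h1 : |t' - t| ≤ 0 := hδz ▸ le_max_left _ _
      have h2 : ‖x' - x‖ ≤ 0 := hδz ▸ le_max_right _ _
      have e1 : t' = t := by
        have := abs_nonpos_iff.1 h1; linarith
      have e2 : x' = x := by
        have := norm_le_zero_iff.1 h2; exact sub_eq_zero.1 this
      subst e1; subst e2
      simp only [sub_self, norm_zero]
      positivity
    set c : ℝ := δ ^ (1 / 4 : ℝ) with hc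
    have hc0 : 0 < c := Real.rpow_pos_of_pos hδpos _
    have hδc : δ = c ^ 4 := by
      rw [hc, ← Real.rpow_natCast, ← Real.rpow_mul hδpos.le]; norm_num
    rcases le_or_gt δ 1 with hδ1 | hδ1
    · -- main case `0 < δ ≤ 1`: `ε = √δ = c²`
      have hc1 : c ≤ 1 := by
        rw [hc]; exact Real.rpow_le_one hδpos.le hδ1 (by norm_num)
      set ε : ℝ := c ^ 2 with hε
      have hε0 : 0 < ε := by positivity
      have hε1 : ε ≤ 1 := by rw [hε]; nlinarith
      have hεr : ε ^ (-(1 / 2 : ℝ)) = c⁻¹ := sq_rpow_neg_half_eq_inv hc0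
      have hsε : Real.sqrt ε = c := by rw [hε, Real.sqrt_sq hc0.le]
      have hsδ : Real.sqrt δ = c ^ 2 := by
        rw [hδc, show c ^ 4 = (c ^ 2) ^ 2 by ring, Real.sqrt_sq (by positivity)]
      have hc2 : c ^ 2 ≤ c := by nlinarith
      -- space step at time `t'`
      have hxx : ‖x' - x‖ ≤ δ := le_max_right _ _
      have h1 : ‖u t' x' - u t' x‖ ≤ D * m * c ^ 3 + 4 * C * m ^ 2 * c := by
        have h := hspace t' ht' ε hε0 hε1 x x'
        rw [hεr, hsε] at h
        refine h.trans ?_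
        have : D * c⁻¹ * m * ‖x' - x‖ ≤ D * c⁻¹ * m * δ := by gcongr
        have e : D * c⁻¹ * m * δ = D * m * c ^ 3 := by
          rw [hδc]; field_simp
        linarith
      -- time step at the point `x`
      have h2 : ‖u t' x - u t x‖ ≤ H * D * m * c + 4 * C * m ^ 2 * c + 2 * C * m ^ 2 * c ^ 2 := by
        rcases htt'.eq_or_lt with heq | hlt
        · subst heq; simp only [sub_self, norm_zero]; positivity
        · have h := htime t ht t' ht' hlt ε hε0 hε1 x
          rw [hεr, hsε] at h
          have hh : t' - t ≤ δ := (le_abs_self _).trans (le_max_left _ _)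
          have hh0 : 0 ≤ t' - t := by linarith
          have hsh : Real.sqrt (t' - t) ≤ c ^ 2 := hsδ ▸ Real.sqrt_le_sqrt hh
          have hrh : (t' - t) ^ ((1 : ℝ) / 2) ≤ c ^ 2 := by
            rw [show (1 : ℝ) / 2 = 1 / 2 by norm_num, ← Real.sqrt_eq_rpow]; exact hsh
          refine h.trans ?_
          have e1 : H * (D * c⁻¹ * m) * (t' - t) ^ ((1 : ℝ) / 2) ≤ H * (D * c⁻¹ * m) * c ^ 2 := by gcongr
          have e2 : H * (D * c⁻¹ * m) * c ^ 2 = H * D * m * c := by field_simp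
          have e3 : 2 * C * m ^ 2 * Real.sqrt (t' - t) ≤ 2 * C * m ^ 2 * c ^ 2 := by gcongr
          linarith
      -- combine: every power of `c` is at most `c`
      have hc3 : c ^ 3 ≤ c := by nlinarith
      calc ‖u t' x' - u t x‖ = ‖(u t' x' - u t' x) + (u t' x - u t x)‖ := by rw [sub_add_sub_cancel]
        _ ≤ ‖u t' x' - u t' x‖ + ‖u t' x - u t x‖ := norm_add_le _ _
        _ ≤ (D * m * c ^ 3 + 4 * C * m ^ 2 * c) +
              (H * D * m * c + 4 * C * m ^ 2 * c + 2 * C * m ^ 2 * c ^ 2) := add_le_add h1 h2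
        _ ≤ D * m * c + 4 * C * m ^ 2 * c + (H * D * m * c + 4 * C * m ^ 2 * c + 2 * C * m ^ 2 * c) := by
              have : D * m * c ^ 3 ≤ D * m * c := by
                have := mul_le_mul_of_nonneg_left hc3 (by positivity : 0 ≤ D * m); linarith
              have : 2 * C * m ^ 2 * c ^ 2 ≤ 2 * C * m ^ 2 * c := by
                have := mul_le_mul_of_nonneg_left hc2 (by positivity : 0 ≤ 2 * C * m ^ 2); linarith
              linarith
        _ = ((D + H * D) * m + 10 * C * m ^ 2) * c := by ring
        _ ≤ (D + H * D + 10 * C + 2) * (m + m ^ 2) * c := by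
              apply mul_le_mul_of_nonneg_right _ hc0.le
              have h3 : 0 ≤ (D + H * D) * m ^ 2 := by positivity
              have h4 : 0 ≤ 10 * C * m := by positivity
              have h5 : 0 ≤ 2 * (m + m ^ 2) := by positivity
              nlinarith [h3, h4, h5]
    · -- `δ > 1`: the trivial bound
      have hc1 : 1 ≤ c := by
        rw [hc]; exact Real.one_le_rpow hδ1.le (by norm_num)
      calc ‖u t' x' - u t x‖ ≤ 2 * m := htriv
        _ ≤ (D + H * D + 10 * C + 2) * (m + m ^ 2) * 1 := by nlinarith [sq_nonneg m]
        _ ≤ (D + H * D + 10 * C + 2) * (m + m ^ 2) * c := by gcongr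
  -- ### symmetry in `(t, x) ↔ (t', x')`
  intro t ht t' ht' x x'
  rcases le_total t t' with h | h
  · exact key t ht t' ht' h x x'
  · have hk := key t' ht' t ht h x' x
    rwa [norm_sub_rev, abs_sub_comm, norm_sub_rev x] at hk

end Literature.Analysis.FluidPDE

end
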